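import Summits.Ventures.LatticeQCDFlow.Exactness.FlowSamplerSymmetrisation
import Summits.Ventures.LatticeQCDFlow.Exactness.FlowSamplerSquareIntegrableAcceptanceCeiling
import Summits.Ventures.LatticeQCDFlow.Exactness.FlowSamplerSquareIntegrableCeiling
import Summits.Ventures.LatticeQCDFlow.Exactness.ReversibleVariationalTauInt
import HarnessLib

/-!
# SYMMETRISATION NEVER INCREASES `τ_int` OF ANY EVEN OR ODD OBSERVABLE: the Dirichlet form of the symmetrised flow sampler dominates that of the flow sampler on each parity sector

HONEST FRAMING: exact (Metropolis-corrected) sampling algorithms for lattice gauge theory;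
figures of merit are autocorrelation/cost numbers at stated couplings and volumes; no
continuum-physics claim.  (SCALAR calibration rung S0-A: not a gauge result.)

Venture `LatticeQCDFlow` (cell pub-lqcd), topic `Exactness`; FANOUT row 2 (`s0-phi4`, FLOW arm
`K_q = imhOp μ w q̃`, symmetrised arm `K_s = imhOp μ w q̃ₛ`, `q̃ₛ = ½(q̃ + q̃∘σ)`).  NEW WORK of the cell:
a Dirichlet-form (Peskun–Tierney-type) comparison, assembled from the tree's FORMAT-level variational
calculus for reversible samplers — the sharp variational inequality under summability
`(∫ g v w)² ≤ P·(Σ_{k≥0} ρ_q(k))·𝓔_q(v)` (`ReversibleVariationalTauInt`, Abel limits) and the converse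
'variational bound + positivity ⇒ summable with `τ_int ≤ B/P − ½`' (`ReversibleVariationalCeilingPositive`)
— and the Dirichlet-form representation `𝓔(v) = ½∫∫ s(x,y)(v(x) − v(y))²` of
`FlowSamplerSquareIntegrableCeiling`, `s = min(w q', w' q)`.  Three pointwise facts drive it:
`s_{q̃ₛ}(x,y) ≥ ½(s_q̃(x,y) + s_q̃(σx,σy))` (`min` superadditive), `s_{q̃ₛ}(σx,σy) = s_{q̃ₛ}(x,y)`, and
`((a + cb)/2)² ≤ ½(a² + b²)` for `c² = 1`; plus the change of variables `(x,y) ↦ (σx,σy)` on `μ ⊗ μ`.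
Printed counterparts NAMED ONLY: Peskun 1973 / Tierney 1998 (covariance ordering via Dirichlet forms),
Andrieu–Livingstone 2021 (Peskun–Tierney orderings beyond); nothing is cited as a fact.

## What is proved (`σ` a measure-preserving involution, `w ∘ σ = w`, `w, q̃ > 0`, `∫ q̃ = 1`; class
`A = {measurable, ∫ v² w < ∞}`; a PARITY-HOMOGENEOUS function is one with `u ∘ σ = c·u`, `c² = 1`)

* `integral_comp_prodMap_involution` — `∫ F(σx, σy) d(μ⊗μ) = ∫ F d(μ⊗μ)`;
* `symmetrised_imhFlow_ge`, `symmetrised_imhFlow_comp_symm` — the two kernel facts above;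
* **`symmetrised_dirichlet_ge_of_parity`** — `𝓔_s(u) ≥ 𝓔_q(u)` for every parity-homogeneous `u ∈ A`;
* `symmetrised_dirichlet_comp_symm` — `𝓔_s(v ∘ σ) = 𝓔_s(v)`; **`symmetrised_dirichlet_parityPart_le`** —
  `𝓔_s(½(v + c·v∘σ)) ≤ 𝓔_s(v)` for every `v ∈ A` (midpoint convexity of the Dirichlet form);
* `inner_parityPart_eq` — `∫ g·½(v + c·v∘σ)·w = ∫ g v w` for `g ∘ σ = c·g`;
* **`symmetrised_tauInt_le_of_parity`** — THE COMPARISON: `g ∈ A`, `∫ g² w > 0`, `g ∘ σ = c·g`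
  (`c² = 1`: EVEN or ODD), the normalised autocorrelation series of `g` under `K_q` summable ⇒ under
  `K_s` it is summable too and **`τ_int^{q̃ₛ}(g) ≤ τ_int^{q̃}(g)`**.

The lattice instances (every even or odd `f ∈ PolyObs` of φ⁴ — energy, `χ₂`, `G(0,0)`, `M`, `Σφ³` —
and the Gaussian-minorant unconditional form) are drawn in `Phi4FlowSymmetrisedParity`.
NOT CLAIMED: anything for observables of mixed parity beyond what linearity gives; strictness; any
value for any network; cost accounting (two density evaluations per proposal); HMC / local arms.
-/

namespace Summit.Ventures.LatticeQCDFlow.Exactness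

open Real MeasureTheory Filter Finset Set Topology
open Summit.Ventures.LatticeQCDFlow.Scoring

/-- `((a + c b)/2)² ≤ (a² + b²)/2` when `c² = 1` (`0 ≤ (a − c b)²`). -/
theorem sq_midpoint_sign_le {a b c : ℝ} (hc : c ^ 2 = 1) :
    ((a + c * b) / 2) ^ 2 ≤ (a ^ 2 + b ^ 2) / 2 := by
  nlinarith [sq_nonneg (a - c * b), hc]

section General

variable {X : Type*} [MeasurableSpace X] {μ : Measure X} [SFinite μ] {w q : X → ℝ} {σ : X → X}

/-! ## §1 The involution on the product space -/

/-- `(x, y) ↦ (σx, σy)` preserves `μ ⊗ μ`: `∫ F(σx, σy) = ∫ F`. -/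
theorem integral_comp_prodMap_involution (hσ : MeasurePreserving σ μ μ) (hσσ : ∀ x, σ (σ x) = x)
    (F : X × X → ℝ) : ∫ p, F (σ p.1, σ p.2) ∂(μ.prod μ) = ∫ p, F p ∂(μ.prod μ) := by
  have hinv : ∀ p : X × X, Prod.map σ σ (Prod.map σ σ p) = p := fun p => by
    simp only [Prod.map, hσσ]
  have hemb : MeasurableEmbedding (Prod.map σ σ) :=
    (⟨⟨Prod.map σ σ, Prod.map σ σ, hinv, hinv⟩, hσ.measurable.prodMap hσ.measurable,
      hσ.measurable.prodMap hσ.measurable⟩ : X × X ≃ᵐ X × X).measurableEmbedding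
  exact (hσ.prod hσ).integral_comp hemb F

/-- … and `F ∘ (σ×σ) ∈ L¹(μ ⊗ μ)` whenever `F ∈ L¹(μ ⊗ μ)`. -/
theorem integrable_comp_prodMap_involution (hσ : MeasurePreserving σ μ μ) (hσσ : ∀ x, σ (σ x) = x)
    {F : X × X → ℝ} (hF : Integrable F (μ.prod μ)) :
    Integrable (fun p : X × X => F (σ p.1, σ p.2)) (μ.prod μ) := by
  have hinv : ∀ p : X × X, Prod.map σ σ (Prod.map σ σ p) = p := fun p => by
    simp only [Prod.map, hσσ]
  have hemb : MeasurableEmbedding (Prod.map σ σ) :=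
    (⟨⟨Prod.map σ σ, Prod.map σ σ, hinv, hinv⟩, hσ.measurable.prodMap hσ.measurable,
      hσ.measurable.prodMap hσ.measurable⟩ : X × X ≃ᵐ X × X).measurableEmbedding
  exact ((hσ.prod hσ).integrable_comp_emb hemb).2 hF

/-! ## §2 Two kernel facts -/

omit [MeasurableSpace X] in
/-- **The symmetrised flow kernel dominates the orbit average of the flow kernel**:
`½(s_q̃(x,y) + s_q̃(σx,σy)) ≤ s_{q̃ₛ}(x,y)`, `s_q(x,y) = min(w(x)q(y), w(y)q(x))` (`w ∘ σ = w`). -/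
theorem symmetrised_imhFlow_ge (hw : ∀ t, w (σ t) = w t) (x y : X) :
    (imhFlow w q x y + imhFlow w q (σ x) (σ y)) / 2
      ≤ imhFlow w (fun s => (q s + q (σ s)) / 2) x y := by
  unfold imhFlow
  beta_reduce
  rw [hw x, hw y]
  have h := min_add_min_le_min_add (w x * q y) (w x * q (σ y)) (w y * q x) (w y * q (σ x))
  have e1 : w x * ((q y + q (σ y)) / 2) = (w x * q y + w x * q (σ y)) / 2 := by ring
  have e2 : w y * ((q x + q (σ x)) / 2) = (w y * q x + w y * q (σ x)) / 2 := by ring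
  rw [e1, e2, min_div_div_right (by norm_num : (0:ℝ) ≤ 2)]
  exact div_le_div_of_nonneg_right h (by norm_num)

omit [MeasurableSpace X] in
/-- The symmetrised kernel is `σ×σ`-invariant: `s_{q̃ₛ}(σx, σy) = s_{q̃ₛ}(x, y)`. -/
theorem symmetrised_imhFlow_comp_symm (hσσ : ∀ x, σ (σ x) = x) (hw : ∀ t, w (σ t) = w t)
    (x y : X) :
    imhFlow w (fun s => (q s + q (σ s)) / 2) (σ x) (σ y)
      = imhFlow w (fun s => (q s + q (σ s)) / 2) x y := by
  unfold imhFlow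
  beta_reduce
  rw [hw x, hw y, hσσ x, hσσ y, add_comm (q (σ y)) (q y), add_comm (q (σ x)) (q x)]

omit [SFinite μ] in
/-- `s(x,y)(u(x) − u(y))² ∈ L¹(μ ⊗ μ)` for every `u ∈ A` (any positive model density `q`). -/
theorem integrable_imhFlow_mul_sq_sub (hw0 : ∀ t, 0 < w t) (hwm : Measurable w)
    (hq0 : ∀ t, 0 < q t) (hqm : Measurable q) (hqi : Integrable q μ)
    {u : X → ℝ} (hum : Measurable u) (hu2 : Integrable (fun t => u t ^ 2 * w t) μ) :
    Integrable (fun p : X × X => imhFlow w q p.1 p.2 * (u p.1 - u p.2) ^ 2) (μ.prod μ) := by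
  have huw : Integrable (fun t => u t ^ 2 * w t) μ := hu2
  have hA : Integrable (fun p : X × X => imhFlow w q p.1 p.2 * u p.1 ^ 2) (μ.prod μ) :=
    integrable_imhFlow_mul_fst hw0 hwm hq0 hqm hqi (hum.pow_const 2) huw
  have hB : Integrable (fun p : X × X => imhFlow w q p.1 p.2 * u p.2 ^ 2) (μ.prod μ) :=
    integrable_imhFlow_mul_snd hw0 hwm hq0 hqm hqi (hum.pow_const 2) huw
  have hC := integrable_imhFlow_mul_mul_of_sq hw0 hwm hq0 hqm hqi hum hum hu2 hu2
  refine ((hA.add hB).sub (hC.const_mul 2)).congr (Eventually.of_forall fun p => ?_)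
  show imhFlow w q p.1 p.2 * u p.1 ^ 2 + imhFlow w q p.1 p.2 * u p.2 ^ 2
      - 2 * (imhFlow w q p.1 p.2 * u p.2 * u p.1) = imhFlow w q p.1 p.2 * (u p.1 - u p.2) ^ 2
  ring

/-! ## §3 Dirichlet-form domination on parity-homogeneous functions -/

/-- **`𝓔_{q̃ₛ}(u) ≥ 𝓔_q̃(u)` FOR EVERY PARITY-HOMOGENEOUS SQUARE-INTEGRABLE `u`** (`u ∘ σ = c·u`,
`c² = 1`): `∫ u² w − ∫ u (K_q u) w ≤ ∫ u² w − ∫ u (K_s u) w`. -/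
theorem symmetrised_dirichlet_ge_of_parity (hσ : MeasurePreserving σ μ μ) (hσσ : ∀ x, σ (σ x) = x)
    (hw0 : ∀ t, 0 < w t) (hwm : Measurable w) (hwi : Integrable w μ) (hw : ∀ t, w (σ t) = w t)
    (hq0 : ∀ t, 0 < q t) (hqm : Measurable q) (hqi : Integrable q μ) (hq1 : ∫ z, q z ∂μ = 1)
    {u : X → ℝ} (hum : Measurable u) (hu2 : Integrable (fun t => u t ^ 2 * w t) μ)
    {c : ℝ} (hc : c ^ 2 = 1) (hu : ∀ x, u (σ x) = c * u x) :
    (∫ t, u t ^ 2 * w t ∂μ) - ∫ t, u t * imhOp μ w q u t * w t ∂μ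
      ≤ (∫ t, u t ^ 2 * w t ∂μ) - ∫ t, u t * imhOp μ w (fun s => (q s + q (σ s)) / 2) u t * w t ∂μ := by
  obtain ⟨hs0, hsm, hsi, hs1, -⟩ := symmetrised_facts hσ hσσ hq0 hqm hqi hq1
  rw [dirichlet_eq_half_sq_of_sq hw0 hwm hwi hq0 hqm hqi hq1 hum hu2,
    dirichlet_eq_half_sq_of_sq hw0 hwm hwi hs0 hsm hsi hs1 hum hu2]
  refine mul_le_mul_of_nonneg_left ?_ (by norm_num)
  set F : X × X → ℝ := fun p => imhFlow w q p.1 p.2 * (u p.1 - u p.2) ^ 2 with hF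
  have hFi : Integrable F (μ.prod μ) := integrable_imhFlow_mul_sq_sub hw0 hwm hq0 hqm hqi hum hu2
  have hFσi : Integrable (fun p : X × X => F (σ p.1, σ p.2)) (μ.prod μ) :=
    integrable_comp_prodMap_involution hσ hσσ hFi
  have hFσ_eq : ∀ p : X × X, F (σ p.1, σ p.2) = imhFlow w q (σ p.1) (σ p.2) * (u p.1 - u p.2) ^ 2 :=
    fun p => by
      show imhFlow w q (σ p.1) (σ p.2) * (u (σ p.1) - u (σ p.2)) ^ 2
        = imhFlow w q (σ p.1) (σ p.2) * (u p.1 - u p.2) ^ 2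
      rw [hu, hu]
      have e : (c * u p.1 - c * u p.2) ^ 2 = c ^ 2 * (u p.1 - u p.2) ^ 2 := by ring
      rw [e, hc, one_mul]
  have hσint : ∫ p, F (σ p.1, σ p.2) ∂(μ.prod μ) = ∫ p, F p ∂(μ.prod μ) :=
    integral_comp_prodMap_involution hσ hσσ F
  have hGi : Integrable (fun p : X × X => imhFlow w (fun s => (q s + q (σ s)) / 2) p.1 p.2
      * (u p.1 - u p.2) ^ 2) (μ.prod μ) :=
    integrable_imhFlow_mul_sq_sub hw0 hwm hs0 hsm hsi hum hu2
  have hpt : ∀ p : X × X, (F p + F (σ p.1, σ p.2)) / 2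
      ≤ imhFlow w (fun s => (q s + q (σ s)) / 2) p.1 p.2 * (u p.1 - u p.2) ^ 2 := fun p => by
    rw [hFσ_eq p]
    have h := symmetrised_imhFlow_ge (q := q) hw p.1 p.2
    have e : (F p + imhFlow w q (σ p.1) (σ p.2) * (u p.1 - u p.2) ^ 2) / 2
        = (imhFlow w q p.1 p.2 + imhFlow w q (σ p.1) (σ p.2)) / 2 * (u p.1 - u p.2) ^ 2 := by
      simp only [hF]
      ring
    rw [e]
    exact mul_le_mul_of_nonneg_right h (sq_nonneg _)
  calc ∫ p, F p ∂(μ.prod μ) = ∫ p, (F p + F (σ p.1, σ p.2)) / 2 ∂(μ.prod μ) := by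
        rw [integral_div, integral_add hFi hFσi, hσint]
        ring
    _ ≤ ∫ p, imhFlow w (fun s => (q s + q (σ s)) / 2) p.1 p.2 * (u p.1 - u p.2) ^ 2 ∂(μ.prod μ) :=
        integral_mono ((hFi.add hFσi).div_const 2) hGi hpt

/-! ## §4 Midpoint convexity and `σ`-invariance of the symmetrised Dirichlet form -/

omit [SFinite μ] in
/-- `v ∘ σ` is square-integrable when `v` is (`w` even, `σ` measure-preserving). -/
theorem sqClass_comp_symm (hσ : MeasurePreserving σ μ μ) (hσσ : ∀ x, σ (σ x) = x)
    (hw : ∀ t, w (σ t) = w t) {v : X → ℝ} (hvm : Measurable v)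
    (hv2 : Integrable (fun t => v t ^ 2 * w t) μ) :
    Measurable (fun x => v (σ x)) ∧ Integrable (fun t => v (σ t) ^ 2 * w t) μ := by
  refine ⟨hvm.comp hσ.measurable, ?_⟩
  have h := integrable_comp_involution hσ hσσ hv2
  exact h.congr (Eventually.of_forall fun t => by simp only [hw])

/-- **`𝓔_s(v ∘ σ) = 𝓔_s(v)`** (the symmetrised kernel is `σ×σ`-invariant; change of variables). -/
theorem symmetrised_dirichlet_comp_symm (hσ : MeasurePreserving σ μ μ) (hσσ : ∀ x, σ (σ x) = x)
    (hw0 : ∀ t, 0 < w t) (hwm : Measurable w) (hwi : Integrable w μ) (hw : ∀ t, w (σ t) = w t)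
    (hq0 : ∀ t, 0 < q t) (hqm : Measurable q) (hqi : Integrable q μ) (hq1 : ∫ z, q z ∂μ = 1)
    {v : X → ℝ} (hvm : Measurable v) (hv2 : Integrable (fun t => v t ^ 2 * w t) μ) :
    (∫ t, v (σ t) ^ 2 * w t ∂μ)
        - ∫ t, v (σ t) * imhOp μ w (fun s => (q s + q (σ s)) / 2) (fun x => v (σ x)) t * w t ∂μ
      = (∫ t, v t ^ 2 * w t ∂μ)
        - ∫ t, v t * imhOp μ w (fun s => (q s + q (σ s)) / 2) v t * w t ∂μ := by
  obtain ⟨hs0, hsm, hsi, hs1, -⟩ := symmetrised_facts hσ hσσ hq0 hqm hqi hq1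
  obtain ⟨hvσm, hvσ2⟩ := sqClass_comp_symm hσ hσσ hw hvm hv2
  rw [dirichlet_eq_half_sq_of_sq hw0 hwm hwi hs0 hsm hsi hs1 hvσm hvσ2,
    dirichlet_eq_half_sq_of_sq hw0 hwm hwi hs0 hsm hsi hs1 hvm hv2,
    ← integral_comp_prodMap_involution hσ hσσ (fun p : X × X =>
      imhFlow w (fun s => (q s + q (σ s)) / 2) p.1 p.2 * (v p.1 - v p.2) ^ 2)]
  congr 1
  refine integral_congr_ae (Eventually.of_forall fun p => ?_)
  show imhFlow w (fun s => (q s + q (σ s)) / 2) p.1 p.2 * (v (σ p.1) - v (σ p.2)) ^ 2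
    = imhFlow w (fun s => (q s + q (σ s)) / 2) (σ p.1) (σ p.2) * (v (σ p.1) - v (σ p.2)) ^ 2
  rw [symmetrised_imhFlow_comp_symm hσσ hw]

/-- **MIDPOINT CONVEXITY: `𝓔_s(½(v + c·v∘σ)) ≤ 𝓔_s(v)`** for every square-integrable `v` and
`c² = 1` (pointwise `((a + cb)/2)² ≤ ½(a² + b²)` under the Dirichlet representation, then
`𝓔_s(v∘σ) = 𝓔_s(v)`). -/
theorem symmetrised_dirichlet_parityPart_le (hσ : MeasurePreserving σ μ μ)
    (hσσ : ∀ x, σ (σ x) = x) (hw0 : ∀ t, 0 < w t) (hwm : Measurable w) (hwi : Integrable w μ)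
    (hw : ∀ t, w (σ t) = w t) (hq0 : ∀ t, 0 < q t) (hqm : Measurable q) (hqi : Integrable q μ)
    (hq1 : ∫ z, q z ∂μ = 1) {v : X → ℝ} (hvm : Measurable v)
    (hv2 : Integrable (fun t => v t ^ 2 * w t) μ) {c : ℝ} (hc : c ^ 2 = 1) :
    (∫ t, ((v t + c * v (σ t)) / 2) ^ 2 * w t ∂μ)
        - ∫ t, ((v t + c * v (σ t)) / 2)
            * imhOp μ w (fun s => (q s + q (σ s)) / 2) (fun x => (v x + c * v (σ x)) / 2) t * w t ∂μ
      ≤ (∫ t, v t ^ 2 * w t ∂μ)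
        - ∫ t, v t * imhOp μ w (fun s => (q s + q (σ s)) / 2) v t * w t ∂μ := by
  obtain ⟨hs0, hsm, hsi, hs1, -⟩ := symmetrised_facts hσ hσσ hq0 hqm hqi hq1
  obtain ⟨hvσm, hvσ2⟩ := sqClass_comp_symm hσ hσσ hw hvm hv2
  -- the parity part is square-integrable: `(v + c ṽ)/2 = v·? ` use (comb) with coefficient, then scale
  have hpc : Measurable (fun x => (v x + c * v (σ x)) / 2) ∧
      Integrable (fun t => ((v t + c * v (σ t)) / 2) ^ 2 * w t) μ := by
    obtain ⟨hm, hi⟩ := sqClass_comb hw0 hwm c ⟨hvm, hv2⟩ ⟨hvσm, hvσ2⟩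
    refine ⟨hm.div_const 2, (hi.div_const 4).congr (Eventually.of_forall fun t => ?_)⟩
    show (v t + c * v (σ t)) ^ 2 * w t / 4 = ((v t + c * v (σ t)) / 2) ^ 2 * w t
    ring
  have hEσ := symmetrised_dirichlet_comp_symm hσ hσσ hw0 hwm hwi hw hq0 hqm hqi hq1 hvm hv2
  rw [dirichlet_eq_half_sq_of_sq hw0 hwm hwi hs0 hsm hsi hs1 hvσm hvσ2,
    dirichlet_eq_half_sq_of_sq hw0 hwm hwi hs0 hsm hsi hs1 hvm hv2] at hEσ
  rw [dirichlet_eq_half_sq_of_sq hw0 hwm hwi hs0 hsm hsi hs1 hpc.1 hpc.2,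
    dirichlet_eq_half_sq_of_sq hw0 hwm hwi hs0 hsm hsi hs1 hvm hv2]
  refine mul_le_mul_of_nonneg_left ?_ (by norm_num)
  have hI := integrable_imhFlow_mul_sq_sub hw0 hwm hs0 hsm hsi hvm hv2
  have hIσ := integrable_imhFlow_mul_sq_sub hw0 hwm hs0 hsm hsi hvσm hvσ2
  have hIc := integrable_imhFlow_mul_sq_sub hw0 hwm hs0 hsm hsi hpc.1 hpc.2
  have hpt : ∀ p : X × X, imhFlow w (fun s => (q s + q (σ s)) / 2) p.1 p.2
      * ((v p.1 + c * v (σ p.1)) / 2 - (v p.2 + c * v (σ p.2)) / 2) ^ 2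
        ≤ (imhFlow w (fun s => (q s + q (σ s)) / 2) p.1 p.2 * (v p.1 - v p.2) ^ 2
          + imhFlow w (fun s => (q s + q (σ s)) / 2) p.1 p.2 * (v (σ p.1) - v (σ p.2)) ^ 2) / 2 :=
    fun p => by
      have hs := (imhFlow_nonneg_le hw0 hs0 p.1 p.2).1
      have h := sq_midpoint_sign_le (a := v p.1 - v p.2) (b := v (σ p.1) - v (σ p.2)) hc
      have e : (v p.1 + c * v (σ p.1)) / 2 - (v p.2 + c * v (σ p.2)) / 2
          = ((v p.1 - v p.2) + c * (v (σ p.1) - v (σ p.2))) / 2 := by ring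
      rw [e]
      have e2 : (imhFlow w (fun s => (q s + q (σ s)) / 2) p.1 p.2 * (v p.1 - v p.2) ^ 2
          + imhFlow w (fun s => (q s + q (σ s)) / 2) p.1 p.2 * (v (σ p.1) - v (σ p.2)) ^ 2) / 2
          = imhFlow w (fun s => (q s + q (σ s)) / 2) p.1 p.2
            * (((v p.1 - v p.2) ^ 2 + (v (σ p.1) - v (σ p.2)) ^ 2) / 2) := by ring
      rw [e2]
      exact mul_le_mul_of_nonneg_left h hs
  have half_sum : (1 / 2 : ℝ) * ∫ p, imhFlow w (fun s => (q s + q (σ s)) / 2) p.1 p.2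
      * (v (σ p.1) - v (σ p.2)) ^ 2 ∂(μ.prod μ)
      = (1 / 2 : ℝ) * ∫ p, imhFlow w (fun s => (q s + q (σ s)) / 2) p.1 p.2
        * (v p.1 - v p.2) ^ 2 ∂(μ.prod μ) := hEσ
  calc ∫ p, imhFlow w (fun s => (q s + q (σ s)) / 2) p.1 p.2
        * ((v p.1 + c * v (σ p.1)) / 2 - (v p.2 + c * v (σ p.2)) / 2) ^ 2 ∂(μ.prod μ)
      ≤ ∫ p, (imhFlow w (fun s => (q s + q (σ s)) / 2) p.1 p.2 * (v p.1 - v p.2) ^ 2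
          + imhFlow w (fun s => (q s + q (σ s)) / 2) p.1 p.2 * (v (σ p.1) - v (σ p.2)) ^ 2) / 2
          ∂(μ.prod μ) := integral_mono hIc ((hI.add hIσ).div_const 2) hpt
    _ = ∫ p, imhFlow w (fun s => (q s + q (σ s)) / 2) p.1 p.2 * (v p.1 - v p.2) ^ 2 ∂(μ.prod μ) := by
        rw [integral_div, integral_add hI hIσ]
        linarith

/-! ## §5 The inner product with a parity-homogeneous observable -/

omit [SFinite μ] in
/-- For `g ∘ σ = c·g` (`c² = 1`) and `g, v ∈ A`: `∫ g · ½(v + c·v∘σ) · w = ∫ g v w`. -/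
theorem inner_parityPart_eq (hσ : MeasurePreserving σ μ μ) (hσσ : ∀ x, σ (σ x) = x)
    (hw0 : ∀ t, 0 < w t) (hwm : Measurable w) (hw : ∀ t, w (σ t) = w t) {g v : X → ℝ}
    (hgm : Measurable g) (hg2 : Integrable (fun t => g t ^ 2 * w t) μ) (hvm : Measurable v)
    (hv2 : Integrable (fun t => v t ^ 2 * w t) μ) {c : ℝ} (hc : c ^ 2 = 1)
    (hg : ∀ x, g (σ x) = c * g x) :
    ∫ x, g x * ((v x + c * v (σ x)) / 2) * w x ∂μ = ∫ x, g x * v x * w x ∂μ := by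
  obtain ⟨hvσm, hvσ2⟩ := sqClass_comp_symm hσ hσσ hw hvm hv2
  have hI1 := sqClass_int hw0 hwm ⟨hgm, hg2⟩ ⟨hvm, hv2⟩
  have hI2 := sqClass_int hw0 hwm ⟨hgm, hg2⟩ ⟨hvσm, hvσ2⟩
  have hshift : ∫ x, g x * v (σ x) * w x ∂μ = c * ∫ x, g x * v x * w x ∂μ := by
    have h : ∫ x, g (σ x) * v (σ (σ x)) * w (σ x) ∂μ = ∫ x, g x * v (σ x) * w x ∂μ :=
      integral_comp_involution hσ hσσ (fun x => g x * v (σ x) * w x)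
    rw [← h, ← integral_const_mul]
    refine integral_congr_ae (Eventually.of_forall fun x => ?_)
    show g (σ x) * v (σ (σ x)) * w (σ x) = c * (g x * v x * w x)
    rw [hg, hσσ, hw]
    ring
  have e : ∀ x, g x * ((v x + c * v (σ x)) / 2) * w x
      = (1 / 2) * (g x * v x * w x) + (c / 2) * (g x * v (σ x) * w x) := fun x => by ring
  simp_rw [e]
  rw [integral_add (hI1.const_mul _) (hI2.const_mul _), integral_const_mul, integral_const_mul,
    hshift]
  have hc' : c * c = 1 := by rw [← sq]; exact hc
  calc 1 / 2 * ∫ x, g x * v x * w x ∂μ + c / 2 * (c * ∫ x, g x * v x * w x ∂μ)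
      = (1 + c * c) / 2 * ∫ x, g x * v x * w x ∂μ := by ring
    _ = ∫ x, g x * v x * w x ∂μ := by rw [hc']; ring

/-! ## §6 The comparison theorem -/

/-- **SYMMETRISATION NEVER INCREASES `τ_int` OF A PARITY-HOMOGENEOUS OBSERVABLE.**  `σ` a
measure-preserving involution, `w ∘ σ = w`, `w, q̃ > 0` measurable integrable, `∫ q̃ = 1`; `g`
measurable, `∫ g² w < ∞`, `∫ g² w > 0`, `g ∘ σ = c·g` with `c² = 1` (even or odd).  If the normalised
autocorrelation series of `g` under the flow sampler `imhOp μ w q̃` is summable, then under the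
symmetrised sampler `imhOp μ w q̃ₛ` it is summable and `τ_int^{q̃ₛ}(g) ≤ τ_int^{q̃}(g)`. -/
theorem symmetrised_tauInt_le_of_parity (hσ : MeasurePreserving σ μ μ) (hσσ : ∀ x, σ (σ x) = x)
    (hw0 : ∀ t, 0 < w t) (hwm : Measurable w) (hwi : Integrable w μ) (hw : ∀ t, w (σ t) = w t)
    (hq0 : ∀ t, 0 < q t) (hqm : Measurable q) (hqi : Integrable q μ) (hq1 : ∫ z, q z ∂μ = 1)
    {g : X → ℝ} (hgm : Measurable g) (hg2 : Integrable (fun t => g t ^ 2 * w t) μ)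
    (hP : 0 < ∫ t, g t ^ 2 * w t ∂μ) {c : ℝ} (hc : c ^ 2 = 1) (hg : ∀ x, g (σ x) = c * g x)
    (hs : Summable fun n => (∫ x, g x * ((imhOp μ w q)^[n + 1] g) x * w x ∂μ)
      / ∫ x, g x ^ 2 * w x ∂μ) :
    (Summable fun n => (∫ x, g x * ((imhOp μ w (fun s => (q s + q (σ s)) / 2))^[n + 1] g) x
        * w x ∂μ) / ∫ x, g x ^ 2 * w x ∂μ) ∧
    tauInt (fun n => (∫ x, g x * ((imhOp μ w (fun s => (q s + q (σ s)) / 2))^[n] g) x * w x ∂μ)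
        / ∫ x, g x ^ 2 * w x ∂μ)
      ≤ tauInt (fun n => (∫ x, g x * ((imhOp μ w q)^[n] g) x * w x ∂μ) / ∫ x, g x ^ 2 * w x ∂μ) := by
  obtain ⟨hs0, hsm, hsi, hs1, -⟩ := symmetrised_facts hσ hσσ hq0 hqm hqi hq1
  set P := ∫ x, g x ^ 2 * w x ∂μ with hPdef
  set Cq : ℕ → ℝ := fun k => ∫ x, g x * ((imhOp μ w q)^[k] g) x * w x ∂μ with hCq
  set T := ∑' k, Cq k / P with hT
  -- positivity of both samplers on `L²(w)`
  have hposq : ∀ k, 0 ≤ Cq k := (acceptanceCeiling_setup_of_sq hw0 hwm hwi hq0 hqm hqi hq1 hgm hg2).2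
  have hposs := (acceptanceCeiling_setup_of_sq hw0 hwm hwi hs0 hsm hsi hs1 hgm hg2).2
  have hT0 : 0 ≤ T := tsum_nonneg fun k => div_nonneg (hposq k) hP.le
  have hB : 0 ≤ P * T := mul_nonneg hP.le hT0
  -- the variational bound for the SYMMETRISED sampler with constant `P·T`
  have hvar : ∀ ⦃v : X → ℝ⦄, (Measurable v ∧ Integrable (fun t => v t ^ 2 * w t) μ) →
      (∫ x, g x * v x * w x ∂μ) ^ 2
        ≤ P * T * ((∫ x, v x ^ 2 * w x ∂μ)
          - ∫ x, v x * imhOp μ w (fun s => (q s + q (σ s)) / 2) v x * w x ∂μ) := by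
    intro v hv
    obtain ⟨hvσm, hvσ2⟩ := sqClass_comp_symm hσ hσσ hw hv.1 hv.2
    -- the parity part of `v`
    have hpc : Measurable (fun x => (v x + c * v (σ x)) / 2) ∧
        Integrable (fun t => ((v t + c * v (σ t)) / 2) ^ 2 * w t) μ := by
      obtain ⟨hm, hi⟩ := sqClass_comb hw0 hwm c hv ⟨hvσm, hvσ2⟩
      refine ⟨hm.div_const 2, (hi.div_const 4).congr (Eventually.of_forall fun t => ?_)⟩
      show (v t + c * v (σ t)) ^ 2 * w t / 4 = ((v t + c * v (σ t)) / 2) ^ 2 * w t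
      ring
    have hparity : ∀ x, (fun x => (v x + c * v (σ x)) / 2) (σ x)
        = c * (fun x => (v x + c * v (σ x)) / 2) x := fun x => by
      show (v (σ x) + c * v (σ (σ x))) / 2 = c * ((v x + c * v (σ x)) / 2)
      rw [hσσ]
      have hc' : c * c = 1 := by rw [← sq]; exact hc
      calc (v (σ x) + c * v x) / 2 = (c * c * v (σ x) + c * v x) / 2 := by rw [hc', one_mul]
        _ = c * ((v x + c * v (σ x)) / 2) := by ring
    -- (i) reduce to the parity part, (ii) sharp variational bound for `K_q`, (iii) domination,
    -- (iv) midpoint convexity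
    have h1 := inner_parityPart_eq hσ hσσ hw0 hwm hw hgm hg2 hv.1 hv.2 hc hg
    have h2 := RevOp.sq_inner_le_tsum_mul_dirichlet (A := fun f : X → ℝ =>
        Measurable f ∧ Integrable (fun t => f t ^ 2 * w t) μ) (K := imhOp μ w q)
      (fun x => (hw0 x).le) (sqClass_int hw0 hwm) (sqClass_comb hw0 hwm)
      (sqClass_stab hw0 hwm hwi hq0 hqm hqi hq1) (sqClass_lin hw0 hwm hwi hq0 hqm hqi)
      (sqClass_symm hw0 hwm hwi hq0 hqm hqi hq1) (sqClass_contr hw0 hwm hwi hq0 hqm hqi hq1)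
      ⟨hgm, hg2⟩ hpc hs
    have h3 := symmetrised_dirichlet_ge_of_parity hσ hσσ hw0 hwm hwi hw hq0 hqm hqi hq1 hpc.1 hpc.2
      hc hparity
    have h4 := symmetrised_dirichlet_parityPart_le hσ hσσ hw0 hwm hwi hw hq0 hqm hqi hq1 hv.1 hv.2 hc
    rw [← h1]
    calc (∫ x, g x * ((v x + c * v (σ x)) / 2) * w x ∂μ) ^ 2
        ≤ P * (T * ((∫ x, ((v x + c * v (σ x)) / 2) ^ 2 * w x ∂μ)
            - ∫ x, ((v x + c * v (σ x)) / 2)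
                * imhOp μ w q (fun x => (v x + c * v (σ x)) / 2) x * w x ∂μ)) := h2
      _ ≤ P * (T * ((∫ x, ((v x + c * v (σ x)) / 2) ^ 2 * w x ∂μ)
            - ∫ x, ((v x + c * v (σ x)) / 2)
                * imhOp μ w (fun s => (q s + q (σ s)) / 2) (fun x => (v x + c * v (σ x)) / 2) x
                * w x ∂μ)) :=
          mul_le_mul_of_nonneg_left (mul_le_mul_of_nonneg_left h3 hT0) hP.le
      _ ≤ P * (T * ((∫ x, v x ^ 2 * w x ∂μ)
            - ∫ x, v x * imhOp μ w (fun s => (q s + q (σ s)) / 2) v x * w x ∂μ)) :=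
          mul_le_mul_of_nonneg_left (mul_le_mul_of_nonneg_left h4 hT0) hP.le
      _ = P * T * ((∫ x, v x ^ 2 * w x ∂μ)
            - ∫ x, v x * imhOp μ w (fun s => (q s + q (σ s)) / 2) v x * w x ∂μ) := by ring
  -- positivity + variational bound ⇒ summable with `τ_int ≤ (P T)/P − ½ = T − ½ = τ_int^{q̃}`
  obtain ⟨hsum, hτ⟩ := RevOp.tauInt_le_of_forall_sq_inner_le_dirichlet_of_nonneg
    (A := fun f : X → ℝ => Measurable f ∧ Integrable (fun t => f t ^ 2 * w t) μ)
    (K := imhOp μ w (fun s => (q s + q (σ s)) / 2)) (sqClass_int hw0 hwm) (sqClass_comb hw0 hwm)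
    (sqClass_stab hw0 hwm hwi hs0 hsm hsi hs1) (sqClass_lin hw0 hwm hwi hs0 hsm hsi)
    (sqClass_symm hw0 hwm hwi hs0 hsm hsi hs1) ⟨hgm, hg2⟩ hP hposs hB hvar
  refine ⟨hsum, hτ.trans (le_of_eq ?_)⟩
  -- `P T / P − ½ = T − ½ = ½ + Σ_{k≥1} ρ_q(k)`
  have hsum0 : Summable fun k => Cq k / P := (summable_nat_add_iff 1).1 hs
  have hC0 : Cq 0 / P = 1 := by
    have e : Cq 0 = P := by
      simp only [hCq, hPdef, Function.iterate_zero, id_eq]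
      exact integral_congr_ae (Eventually.of_forall fun x => by ring)
    rw [e, div_self hP.ne']
  have hTeq : T = 1 + ∑' k, Cq (k + 1) / P := by rw [hT, hsum0.tsum_eq_zero_add, hC0]
  show P * T / P - 1 / 2 = tauInt (fun n => Cq n / P)
  rw [mul_div_cancel_left₀ T hP.ne', hTeq]
  unfold tauInt
  ring

end General

end Summit.Ventures.LatticeQCDFlow.Exactness
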